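import Literature.Probability.LatticeModels.IsingPeierls
import HarnessLib

/-!
# Peierls' bound `m*(β) ≥ 1 - C e^{-cβ}` — discharge of `peierls_bound` (crit-ising.S07)

Topic `Probability/LatticeModels`, namespace `Literature.Probability.LatticeModels`. Theorem-only
companion of `IsingPeierls.lean` (kept apart from `GibbsStatesProofs.lean`, whose import closure is
deliberately light): it **discharges the named fact
`Literature.Probability.LatticeModels.peierls_bound`** of `GibbsStates.lean` (`peierls_bound_holds`):
for the nearest-neighbour Ising model on `ℤ^d`, `d ≥ 2`, there are constants `C` and `c > 0` with

  `m*(β) ≥ 1 - C e^{-cβ}`  for all `β ≥ 0`,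

with the explicit witnesses `C = 64`, `c = 2` (`spontaneousMagnetization_ge_one_sub_exp`).

Sources: R. Peierls, Proc. Camb. Phil. Soc. **32** (1936) 477–481 (the contour argument);
R. B. Griffiths, Phys. Rev. **136** (1964) A437 (its rigorous form); S. Friedli, Y. Velenik,
*Statistical Mechanics of Lattice Systems*, CUP 2017, Thm. 3.25 (3) and §3.7.2 (held text,
pp. 116, 122–127): eq. (3.29) "`μ⁺_{Λ;β,0}(σ₀ = -1) ≤ δ(β)` uniformly in `Λ`, where `δ(β) ↓ 0`",
the consequence `⟨σ₀⟩⁺_{Λ;β,0} = 1 - 2μ⁺_{Λ;β,0}(σ₀ = -1) ≥ 1 - 2δ(β)` and (3.30)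
`m*(β) = ⟨σ₀⟩⁺_{β,0}`, and the Peierls sum (3.40) `δ(β) = (2/3) ∑_{k ≥ 4} k 3^k e^{-2βk}`, which is
`O(e^{-8β})` once `3e^{-2β} < 1`; for `d ≥ 3` the book embeds `ℤ²` into `ℤ^d` (p. 127).

## The proof

Everything substantive is the tree's sorry-free Peierls argument of `IsingPeierls.lean`
(`isingMeasure_plus_box_spinAt_zero_eq_neg_one_le`: `μ⁺_{Λ_L;β,0}(σ₀ = -1) ≤ 1/4` for `β ≥ 4`),
whose proof bounds `μ⁺_{Λ_L;β,0}(σ₀ = -1)` by the Peierls sum `∑_{n ≥ 1} n(n+1) 4ⁿ rⁿ` over the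
dual circuits of the planar slice `ℤ² ↪ ℤ^d` surrounding the origin, at the Griffiths rate
`r = 1 - tanh β = 2/(e^{2β} + 1)` (`isingMeasure_plus_real_allDisagree_le'`). Here the same proof
is run with the rate kept symbolic (`isingMeasure_plus_box_spinAt_zero_eq_neg_one_le_of_rate`):
with `2n(n+1) ≤ 4ⁿ` the `n`-th term is `≤ ½ (16r)ⁿ`, so for `16 r ≤ ½` the sum is
`≤ 8r/(1 - 16r) ≤ 16 r`, uniformly in `L`. Hence `⟨σ₀⟩⁺_{Λ_L;β,0} ≥ 1 - 32 r`
(`one_sub_le_isingCorr_plus_box_zero_of_rate`, Friedli–Velenik's display after (3.29)), and in the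
limit `m*(β) ≥ 1 - 32 r` (`one_sub_le_spontaneousMagnetization_of_rate`, via the tree's
`hasBoxLimit_isingCorr_plus_holds` and `spontaneousMagnetization_eq_plusCorr`). Taking
`r = 2e^{-2β} ≥ 1 - tanh β` gives `m*(β) ≥ 1 - 64 e^{-2β}` whenever `e^{2β} ≥ 64`; when
`e^{2β} < 64` the right-hand side is negative and `m*(β) ≥ 0`
(`spontaneousMagnetization_nonneg_holds`, GKS I). So `C = 64`, `c = 2` serve for all `β ≥ 0`.

## Faithfulness notes

* The discharged statement is exactly the tree fact `peierls_bound` (`∃ C c, 0 < c ∧ ∀ β ≥ 0,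
  1 - C e^{-cβ} ≤ m*(β)` for `d ≥ 2`). The printed Peierls rate in `d = 2` is `e^{-8β}` up to
  constants ((3.40)); the fact only asks for some `c > 0`, and `c = 2` is what the Griffiths-bound
  substitute for the contour flip (documented in `IsingPeierls.lean`) delivers.
* No new definitions and no new named facts (D-0026): theorems only.

## Mathlib status

No Ising model / Peierls argument in Mathlib (searched `Peierls`, `Ising`, `magnetization`).
Anchors: `summable_geometric_of_lt_one`, `tsum_geometric_of_lt_one`, `ENNReal.ofReal_tsum_of_nonneg`,
`ENNReal.tsum_le_tsum`, `measure_iUnion_le`, `measure_biUnion_finset_le`, `ge_of_tendsto`,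
`Real.exp_neg`, `Nat.lt_two_pow_self`; tree anchors as in `IsingPeierls.lean`
(`exists_zdGraph_two_embedding`, `Contour.exists_dualCircuit`, `finite_openCluster_restrictConfig`,
`isingMeasure_plus_real_allDisagree_le'`, `finite_openCluster_agreeConfig`, `one_sub_tanh_eq`,
`hasBoxLimit_isingCorr_plus_holds`, `spontaneousMagnetization_eq_plusCorr`,
`spontaneousMagnetization_nonneg_holds`).

## References

* R. Peierls, *On Ising's model of ferromagnetism*, Proc. Camb. Phil. Soc. 32 (1936) 477–481
  [Peierls1936].
* R. B. Griffiths, *Peierls proof of spontaneous magnetization in a two-dimensional Ising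
  ferromagnet*, Phys. Rev. 136 (1964) A437–A439.
* S. Friedli, Y. Velenik, *Statistical Mechanics of Lattice Systems: A Concrete Mathematical
  Introduction*, CUP (2017), Thm. 3.25, §3.7.2, eqs. (3.29)–(3.30), (3.34), (3.39)–(3.40)
  [FriedliVelenik2017].
-/

noncomputable section

open MeasureTheory Finset Filter Topology
open scoped ENNReal

namespace Literature.Probability.LatticeModels

open Literature.Probability.Percolation

variable {d : ℕ}

/-! ### The Peierls sum at a symbolic rate -/

/-- The `n`-th term of the Peierls sum at rate `r ≥ 0` is at most `½ (16 r)ⁿ`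
(from `2n(n+1) ≤ 4ⁿ`). [folklore] -/
theorem isingPeierls_term_le_of_rate {r : ℝ} (hr : 0 ≤ r) (n : ℕ) :
    (n : ℝ) * (n + 1) * 4 ^ n * r ^ n ≤ 1 / 2 * (16 * r) ^ n := by
  have htwo : 2 * n ≤ 2 ^ n := by
    rcases n with - | m
    · simp
    · rw [pow_succ]
      have := m.lt_two_pow_self
      omega
  have hfour : 2 * n * (n + 1) ≤ 4 ^ n := by
    have h2 : n + 1 ≤ 2 ^ n := n.lt_two_pow_self
    calc 2 * n * (n + 1) ≤ 2 ^ n * 2 ^ n := Nat.mul_le_mul htwo h2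
      _ = 4 ^ n := by rw [← mul_pow]; norm_num
  have h2 : (2 * n * (n + 1) : ℝ) ≤ 4 ^ n := by exact_mod_cast hfour
  have h16 : (16 * r) ^ n = 4 ^ n * ((4 : ℝ) ^ n * r ^ n) := by
    rw [← mul_assoc, ← mul_pow, ← mul_pow]; norm_num
  rw [h16]
  have h4r : 0 ≤ (4 : ℝ) ^ n * r ^ n := by positivity
  calc (n : ℝ) * (n + 1) * 4 ^ n * r ^ n = (n * (n + 1)) * (4 ^ n * r ^ n) := by ring
    _ ≤ (1 / 2 * 4 ^ n) * (4 ^ n * r ^ n) := by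
        refine mul_le_mul_of_nonneg_right ?_ h4r
        linarith
    _ = 1 / 2 * (4 ^ n * (4 ^ n * r ^ n)) := by ring

/-- **Peierls' estimate, uniformly in the box, at a symbolic rate**: for `d ≥ 2`, `β ≥ 0`, any
`r` with `1 - tanh β ≤ r ≤ 1/32`, and every `L`, `μ⁺_{Λ_L;β,0}(σ₀ = -1) ≤ 16 r`. The proof is the
tree's `isingMeasure_plus_box_spinAt_zero_eq_neg_one_le` (`IsingPeierls.lean`) with the rate kept
symbolic: if `σ₀ = -1` (and `σ ≡ +1` off the box), the agreement cluster of the origin restricted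
to the coordinate plane `ℤ² ↪ ℤ^d` is finite, so by `Contour.exists_dualCircuit` the origin is
surrounded by a dual circuit of some length `n ≥ 1` through a plaquette `(k,0)`, `k < n`, all of
whose `n` edges are unsatisfied bonds; there are at most `n(n+1)4ⁿ` such circuits, each
unsatisfied with probability `≤ (1 - tanh β)ⁿ ≤ rⁿ` (`isingMeasure_plus_real_allDisagree_le'`), and
`∑_{n ≥ 1} n(n+1) 4ⁿ rⁿ ≤ ∑_{n ≥ 1} ½ (16r)ⁿ = 8r/(1 - 16r) ≤ 16 r` for `16 r ≤ ½` (Peierls 1936;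
Griffiths 1964; Friedli–Velenik 2017, §3.7.2, eq. (3.29) with the Peierls sum (3.37)–(3.40), the
Griffiths bound of `IsingPeierls.lean` replacing the contour-flip estimate (3.34)).
[cite: FriedliVelenik2017, §3.7.2, eqs. (3.29), (3.37)–(3.40), pp. 122–126] -/
theorem isingMeasure_plus_box_spinAt_zero_eq_neg_one_le_of_rate (hd : 2 ≤ d) {β r : ℝ}
    (hβ0 : 0 ≤ β) (hrate : 1 - Real.tanh β ≤ r) (hr32 : r ≤ 1 / 32) (L : ℕ) :
    (isingMeasure (zdGraph d) (box d L) β 0 .plus) {σ | spinAt 0 σ = -1} ≤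
      ENNReal.ofReal (16 * r) := by
  classical
  obtain ⟨ι, hιi, hι0, hιE⟩ := exists_zdGraph_two_embedding hd
  set μ := isingMeasure (zdGraph d) (box d L) β 0 .plus with hμ
  -- the rate
  have hrate0 : 0 ≤ 1 - Real.tanh β := by
    rw [sub_nonneg, Real.tanh_eq_sinh_div_cosh, div_le_one (Real.cosh_pos _)]
    exact (Real.sinh_lt_cosh _).le
  have hr0 : 0 ≤ r := hrate0.trans hrate
  -- the events "the dual walk `(n+1, k, m, w)` is unsatisfied in the coordinate plane"
  let st : (n : ℕ) → ℕ → ℕ → (Fin n → Fin 2 × Bool) → Site 2 := fun n k m w =>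
    Pi.single 0 (k : ℤ) - wordPos w m
  let S : (n : ℕ) → ℕ → ℕ → (Fin n → Fin 2 × Bool) → Set (SpinConfig (Site d)) :=
    fun n k m w => {σ | ∀ e ∈ (dualEdges (st n k m w) w).image (Sym2.map ι), bondSpin σ e = -1}
  let good : (n : ℕ) → ℕ → ℕ → Finset (Fin n → Fin 2 × Bool) := fun n k m =>
    Finset.univ.filter fun w => (dualEdges (st n k m w) w).card = n
  let Vv : ℕ → Set (SpinConfig (Site d)) := fun n =>
    ⋃ k ∈ Finset.range n, ⋃ m ∈ Finset.range (n + 1), ⋃ w ∈ good n k m, S n k m w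
  -- the support of the measure
  let Supp : Set (SpinConfig (Site d)) := {σ | ∀ x ∉ box d L, σ x = 1}
  have hSupp : μ Suppᶜ = 0 := by
    have hmeasS : MeasurableSet Supp := by
      have : Supp = ⋂ x ∈ ({x | x ∉ box d L} : Set (Site d)),
          (fun σ : SpinConfig (Site d) => σ x) ⁻¹' {1} := by
        ext σ; simp [Supp]
      rw [this]
      exact MeasurableSet.biInter (Set.to_countable _) fun x _ =>
        measurable_pi_apply x (measurableSet_singleton _)
    have hind : Measurable (Suppᶜ.indicator (1 : SpinConfig (Site d) → ℝ)) :=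
      measurable_one.indicator hmeasS.compl
    have hreal : μ.real Suppᶜ = 0 := by
      rw [← integral_indicator_one hmeasS.compl, hμ,
        integral_isingMeasure (zdGraph d) (box d L) β 0 .plus hind]
      have hz : ∀ τ : SpinConfig ↥(box d L), Suppᶜ.indicator (1 : SpinConfig (Site d) → ℝ)
          (glue (box d L) τ .plus) = 0 := by
        intro τ
        refine Set.indicator_of_notMem ?_ _
        simp only [Set.mem_compl_iff, not_not, Supp, Set.mem_setOf_eq]
        intro x hx
        rw [glue_apply_of_notMem _ _ _ hx]
        rfl
      simp [hz]
    exact (measureReal_eq_zero_iff (measure_ne_top _ _)).1 hreal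
  -- a `-` spin at the origin forces one of the events (on the support)
  have hsub : {σ : SpinConfig (Site d) | spinAt 0 σ = -1} ∩ Supp ⊆ ⋃ n, Vv (n + 1) := by
    rintro σ ⟨hσ0, hσout⟩
    have hfin : (openCluster (agreeConfig σ) (ι 0)).Finite := by
      rw [hι0]; exact finite_openCluster_agreeConfig hσout hσ0
    obtain ⟨n, k, hkn, a, w, -, ⟨m, hmn, hpos⟩, hcard, hdisj, -, -⟩ :=
      Contour.exists_dualCircuit (restrictConfig ι (agreeConfig σ))
        (finite_openCluster_restrictConfig hιi (agreeConfig σ) 0 hfin)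
    have ha : a = st n k m w := by simp only [st, ← hpos, add_sub_cancel_right]
    subst ha
    obtain ⟨n', rfl⟩ : ∃ n', n = n' + 1 := ⟨n - 1, by omega⟩
    refine Set.mem_iUnion.2 ⟨n', Set.mem_biUnion (Finset.mem_range.2 hkn)
      (Set.mem_biUnion (Finset.mem_range.2 (Nat.lt_succ_of_le hmn))
        (Set.mem_biUnion (x := w) (by simp [good, hcard]) ?_))⟩
    simp only [S, Set.mem_setOf_eq]
    intro e he
    obtain ⟨e2, he2, rfl⟩ := Finset.mem_image.1 he
    have hedge : e2.map ι ∈ (zdGraph d).edgeSet := hιE e2 (dualEdges_subset_edgeSet _ _ he2)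
    have hnot : e2.map ι ∉ agreeConfig σ := by
      intro hmem
      exact Set.disjoint_left.1 hdisj (Finset.mem_coe.2 he2)
        (show e2 ∈ restrictConfig ι (agreeConfig σ) from hmem)
    rcases bondSpin_eq_one_or_neg_one σ (e2.map ι) with h1 | h1
    · exact absurd ⟨hedge, h1⟩ hnot
    · exact h1
  -- each event has probability `≤ r ^ n`
  have hS : ∀ n k m, ∀ w ∈ good n k m, μ (S n k m w) ≤ ENNReal.ofReal (r ^ n) := by
    intro n k m w hw
    have hwn : (dualEdges (st n k m w) w).card = n := (Finset.mem_filter.1 hw).2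
    rw [← ofReal_measureReal]
    refine ENNReal.ofReal_le_ofReal ?_
    refine (isingMeasure_plus_real_allDisagree_le' (zdGraph d) (box d L) hβ0 le_rfl ?_).trans ?_
    · intro e he
      obtain ⟨e2, he2, rfl⟩ := Finset.mem_image.1 he
      exact hιE e2 (dualEdges_subset_edgeSet _ _ he2)
    · rw [Finset.card_image_of_injective _ (Sym2.map.injective hιi), hwn]
      exact pow_le_pow_left₀ hrate0 hrate n
  have hV : ∀ n, μ (Vv n) ≤ ENNReal.ofReal (1 / 2 * (16 * r) ^ n) := by
    intro n
    calc μ (Vv n)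
        ≤ ∑ k ∈ Finset.range n, μ (⋃ m ∈ Finset.range (n + 1), ⋃ w ∈ good n k m, S n k m w) :=
          measure_biUnion_finset_le _ _
      _ ≤ ∑ k ∈ Finset.range n, ∑ m ∈ Finset.range (n + 1), μ (⋃ w ∈ good n k m, S n k m w) := by
          gcongr; exact measure_biUnion_finset_le _ _
      _ ≤ ∑ k ∈ Finset.range n, ∑ m ∈ Finset.range (n + 1), ∑ w ∈ good n k m, μ (S n k m w) := by
          gcongr; exact measure_biUnion_finset_le _ _
      _ ≤ ∑ k ∈ Finset.range n, ∑ m ∈ Finset.range (n + 1), ∑ w ∈ good n k m,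
            ENNReal.ofReal (r ^ n) := by
          gcongr with k _ m _ w hw; exact hS n k m w hw
      _ ≤ ∑ k ∈ Finset.range n, ∑ m ∈ Finset.range (n + 1), ∑ w : Fin n → Fin 2 × Bool,
            ENNReal.ofReal (r ^ n) := by
          gcongr; exact Finset.subset_univ _
      _ = ENNReal.ofReal ((n : ℝ) * (n + 1) * 4 ^ n * r ^ n) := by
          rw [Finset.sum_const, Finset.sum_const, Finset.sum_const, Finset.card_range,
            Finset.card_range, Finset.card_univ, Fintype.card_fun, Fintype.card_prod,
            Fintype.card_fin, Fintype.card_fin, Fintype.card_bool, nsmul_eq_mul, nsmul_eq_mul,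
            nsmul_eq_mul, ← mul_assoc, ← mul_assoc]
          rw [ENNReal.ofReal_mul (by positivity), ENNReal.ofReal_mul (by positivity),
            ENNReal.ofReal_mul (by positivity)]
          congr 1
          · congr 1
            · rw [ENNReal.ofReal_natCast, ← Nat.cast_succ, ENNReal.ofReal_natCast]
            · rw [show ((4 : ℝ) ^ n) = ((2 * 2) ^ n : ℕ) by push_cast; ring, ENNReal.ofReal_natCast]
      _ ≤ ENNReal.ofReal (1 / 2 * (16 * r) ^ n) :=
          ENNReal.ofReal_le_ofReal (isingPeierls_term_le_of_rate hr0 n)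
  -- the Peierls sum: `∑_{n ≥ 1} ½ (16 r)ⁿ = 8r/(1 - 16r) ≤ 16 r` since `16 r ≤ ½`
  have hq0 : 0 ≤ 16 * r := by positivity
  have hq1 : 16 * r < 1 := by linarith
  have hsum : (∑' n, ENNReal.ofReal (1 / 2 * (16 * r) ^ (n + 1))) ≤ ENNReal.ofReal (16 * r) := by
    have hg : Summable fun n : ℕ => (1 / 2 : ℝ) * (16 * r) ^ (n + 1) := by
      have := ((summable_geometric_of_lt_one hq0 hq1).mul_left (16 * r)).mul_left (1 / 2)
      refine this.congr fun n => ?_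
      rw [pow_succ]; ring
    rw [← ENNReal.ofReal_tsum_of_nonneg (fun n => by positivity) hg]
    refine ENNReal.ofReal_le_ofReal ?_
    have h2 : (fun n : ℕ => (1 / 2 : ℝ) * (16 * r) ^ (n + 1)) =
        fun n => (1 / 2 * (16 * r)) * (16 * r) ^ n := by
      funext n; rw [pow_succ]; ring
    rw [h2, tsum_mul_left, tsum_geometric_of_lt_one hq0 hq1, ← div_eq_mul_inv,
      div_le_iff₀ (by linarith)]
    nlinarith [mul_nonneg hr0 (sub_nonneg.2 hr32)]
  have hUnion : μ (⋃ n, Vv (n + 1)) ≤ ENNReal.ofReal (16 * r) :=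
    (measure_iUnion_le _).trans ((ENNReal.tsum_le_tsum fun n => hV (n + 1)).trans hsum)
  calc μ {σ | spinAt 0 σ = -1}
      ≤ μ ({σ | spinAt 0 σ = -1} ∩ Supp) + μ Suppᶜ := by
        refine (measure_mono ?_).trans (measure_union_le _ _)
        intro σ hσ
        by_cases h : σ ∈ Supp
        · exact Or.inl ⟨hσ, h⟩
        · exact Or.inr h
    _ ≤ ENNReal.ofReal (16 * r) + 0 := add_le_add ((measure_mono hsub).trans hUnion) hSupp.le
    _ = ENNReal.ofReal (16 * r) := add_zero _

/-- `⟨σ₀⟩⁺_{Λ_L;β,0} ≥ 1 - 32 r` for `d ≥ 2`, `β ≥ 0`, `1 - tanh β ≤ r ≤ 1/32` and every `L`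
(`⟨σ₀⟩⁺_{Λ;β,0} = 1 - 2μ⁺_{Λ;β,0}(σ₀ = -1) ≥ 1 - 2δ(β)`, Friedli–Velenik 2017, §3.7.2, the display
following eq. (3.29), with `δ = 16 r` from `isingMeasure_plus_box_spinAt_zero_eq_neg_one_le_of_rate`).
[cite: FriedliVelenik2017, §3.7.2, eq. (3.29) and the display following it, p. 122] -/
theorem one_sub_le_isingCorr_plus_box_zero_of_rate (hd : 2 ≤ d) {β r : ℝ} (hβ0 : 0 ≤ β)
    (hrate : 1 - Real.tanh β ≤ r) (hr32 : r ≤ 1 / 32) (L : ℕ) :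
    1 - 32 * r ≤ isingCorr (zdGraph d) (box d L) β 0 .plus {0} := by
  set μ := isingMeasure (zdGraph d) (box d L) β 0 .plus with hμ
  have hrate0 : 0 ≤ 1 - Real.tanh β := by
    rw [sub_nonneg, Real.tanh_eq_sinh_div_cosh, div_le_one (Real.cosh_pos _)]
    exact (Real.sinh_lt_cosh _).le
  have hr0 : 0 ≤ r := hrate0.trans hrate
  have hmeasE : MeasurableSet {σ : SpinConfig (Site d) | spinAt 0 σ = -1} :=
    measurable_spinAt 0 (measurableSet_singleton _)
  have hP : μ.real {σ | spinAt 0 σ = -1} ≤ 16 * r := by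
    rw [measureReal_def]
    have h := isingMeasure_plus_box_spinAt_zero_eq_neg_one_le_of_rate hd hβ0 hrate hr32 L
    rw [← hμ] at h
    calc (μ {σ | spinAt 0 σ = -1}).toReal ≤ (ENNReal.ofReal (16 * r)).toReal :=
          ENNReal.toReal_mono ENNReal.ofReal_ne_top h
      _ = 16 * r := ENNReal.toReal_ofReal (by positivity)
  -- `σ₀ = 1 - 2·1{σ₀ = -1}`
  have hpt : ∀ σ : SpinConfig (Site d), spinProduct {0} σ =
      1 - 2 * ({σ : SpinConfig (Site d) | spinAt 0 σ = -1}.indicator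
        (1 : SpinConfig (Site d) → ℝ) σ) := by
    intro σ
    simp only [spinProduct, Finset.prod_singleton, Set.indicator_apply, Set.mem_setOf_eq,
      Pi.one_apply]
    rcases spinAt_eq_one_or_eq_neg_one 0 σ with h | h <;> rw [h] <;> norm_num
  have hint : isingCorr (zdGraph d) (box d L) β 0 .plus {0} =
      1 - 2 * μ.real {σ | spinAt 0 σ = -1} := by
    rw [isingCorr, isingExpect, ← hμ]
    simp_rw [hpt]
    rw [integral_sub (integrable_const 1), integral_const, integral_const_mul,
      integral_indicator_one hmeasE]
    · simp
    · exact (integrable_const (1 : ℝ)).indicator hmeasE |>.const_mul 2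
  rw [hint]
  linarith

/-- **`m*(β) ≥ 1 - 32 r`** for `d ≥ 2`, `β ≥ 0` and `1 - tanh β ≤ r ≤ 1/32`: the limit along
boxes of `one_sub_le_isingCorr_plus_box_zero_of_rate` (`m*(β) = ⟨σ₀⟩⁺_{β,0} = lim_L ⟨σ₀⟩⁺_{Λ_L;β,0}`,
Friedli–Velenik 2017, eq. (3.30), via the tree's `hasBoxLimit_isingCorr_plus_holds` and
`spontaneousMagnetization_eq_plusCorr`). [cite: FriedliVelenik2017, §3.7.2, eqs. (3.29)–(3.30), p. 122] -/
theorem one_sub_le_spontaneousMagnetization_of_rate (hd : 2 ≤ d) {β r : ℝ} (hβ0 : 0 ≤ β)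
    (hrate : 1 - Real.tanh β ≤ r) (hr32 : r ≤ 1 / 32) :
    1 - 32 * r ≤ spontaneousMagnetization d β := by
  rw [spontaneousMagnetization_eq_plusCorr]
  exact ge_of_tendsto (hasBoxLimit_isingCorr_plus_holds (d := d) hβ0 le_rfl {0})
    (Filter.Eventually.of_forall fun L =>
      one_sub_le_isingCorr_plus_box_zero_of_rate hd hβ0 hrate hr32 L)

/-- The Griffiths rate is at most twice the Boltzmann factor of a broken bond:
`1 - tanh β = 2/(e^{2β} + 1) ≤ 2 e^{-2β}`. [folklore] -/
theorem one_sub_tanh_le_two_mul_exp_neg (β : ℝ) :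
    1 - Real.tanh β ≤ 2 * Real.exp (-2 * β) := by
  rw [one_sub_tanh_eq, show (-2 : ℝ) * β = -(2 * β) by ring, Real.exp_neg, ← div_eq_mul_inv]
  exact div_le_div_of_nonneg_left (by norm_num) (Real.exp_pos _)
    (by linarith [Real.exp_pos (2 * β)])

/-- **Peierls' bound with explicit constants**: for `d ≥ 2` and every `β ≥ 0`,
`m*(β) ≥ 1 - 64 e^{-2β}`. For `e^{2β} ≥ 64` this is `one_sub_le_spontaneousMagnetization_of_rate`
with `r = 2e^{-2β}` (`≥ 1 - tanh β`, `≤ 1/32`); for `e^{2β} < 64` the right-hand side is negative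
and `m*(β) ≥ 0` by GKS I (`spontaneousMagnetization_nonneg_holds`). (Peierls 1936; Griffiths 1964;
Friedli–Velenik 2017, Thm. 3.25 (3) and §3.7.2, eqs. (3.29)–(3.30), (3.40).)
[cite: FriedliVelenik2017, Thm. 3.25 (3) and §3.7.2, eqs. (3.29)–(3.30), (3.40), pp. 116, 122–126] -/
theorem spontaneousMagnetization_ge_one_sub_exp (hd : 2 ≤ d) {β : ℝ} (hβ : 0 ≤ β) :
    1 - 64 * Real.exp (-2 * β) ≤ spontaneousMagnetization d β := by
  have hexp : Real.exp (-2 * β) = (Real.exp (2 * β))⁻¹ := by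
    rw [show (-2 : ℝ) * β = -(2 * β) by ring, Real.exp_neg]
  by_cases h64 : 64 ≤ Real.exp (2 * β)
  · -- low temperature: `r = 2 e^{-2β} ≤ 1/32`
    have hr32 : 2 * Real.exp (-2 * β) ≤ 1 / 32 := by
      rw [hexp, ← div_eq_mul_inv, div_le_iff₀ (Real.exp_pos _)]
      linarith
    have h := one_sub_le_spontaneousMagnetization_of_rate hd hβ
      (one_sub_tanh_le_two_mul_exp_neg β) hr32
    linarith
  · -- high temperature: the bound is vacuous, `64 e^{-2β} > 1` and `m*(β) ≥ 0`
    have hlt : Real.exp (2 * β) < 64 := not_le.1 h64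
    have h1 : 1 < 64 * Real.exp (-2 * β) := by
      rw [hexp, ← div_eq_mul_inv, lt_div_iff₀ (Real.exp_pos _)]
      linarith
    have h0 : 0 ≤ spontaneousMagnetization d β := spontaneousMagnetization_nonneg_holds hβ
    linarith

/-- **Discharge of `peierls_bound`** (crit-ising.S07; Peierls, Proc. Camb. Phil. Soc. 32 (1936)
477; Griffiths, Phys. Rev. 136 (1964) A437; Friedli–Velenik 2017, Thm. 3.25 (3) with §3.7.2,
eqs. (3.29)–(3.30) and the Peierls sum (3.40)): for `d ≥ 2` there are constants `C` and `c > 0`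
with `m*(β) ≥ 1 - C e^{-cβ}` for all `β ≥ 0` — namely `C = 64`, `c = 2`
(`spontaneousMagnetization_ge_one_sub_exp`). [cite: Peierls1936, pp. 477–481 (via FriedliVelenik2017, Thm. 3.25 (3), §3.7.2)] -/
theorem peierls_bound_holds : peierls_bound (d := d) := fun hd =>
  ⟨64, 2, by norm_num, fun _ hβ => spontaneousMagnetization_ge_one_sub_exp hd hβ⟩

end Literature.Probability.LatticeModels

end
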